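import Summits.QuantumFields.BalabanUV.T4Continuum.Support.TermwiseHeterogeneous

/-!
# TermwiseHeterogeneousWindow — THE WINDOWED CENSUS: the level-graded one-step majorant under the cell's logarithmic
crossover (companion of `Support/TermwiseHeterogeneous`, amending the application of its §4 verdict)

Cell `pub-balaban`, rung (B)+1 sub-cell t4, lineage `b2b-balaban-t4-ne7-p1` (node U5 = NE7, TERM-WISE member;
generation 16), record `t4/T4-EST-NE7-P1.md` §20 (20l).  HONEST FRAMING (page 1): FIXED FINITE T⁴, rung (B)+1,
conditional on BetaPertH and the nine spine estimates (0/9 proved); NOT infinite volume, NOT a mass gap, NOT the Clay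
problem; NE7 NOT PRINTED in [Balaban1984PropagatorsI]–[Balaban1989LargeFieldII], NOT proved here.  [folklore]
real-number bookkeeping over the tree's `T4GoodClassBudget.windowSum`/`jlogOf`/`summable_windowSum_log` and
`T4MatchingClosure.windowSum_log_le`; nothing printed is asserted.

THE POINT.  `TermwiseHeterogeneous` §4 (`summable_ageConv_iff`) evaluates the level-graded majorant
`δ K ≤ C·Σ_{j≤K} μ_K(j)·θ^j` with a `K`-UNIFORM age profile over ALL ages and concludes that, under the d = 4
large-field count, only the King-type class (no rough structure at any age) is reached.  That is the right question
only for a class carrying rough structure of EVERY age.  The cell's hybrid does not ask it: by interface I-3 (T4-DAG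
node U5c, «Bad = histories containing a structure pending at the end with creation scale < j⋆(K)», `j⋆ = jlogOf Cw K`
= `K − ⌈Cw·log(K+1)⌉`; `T4GoodClassBudget` §3b) a GOOD history carries pending (rough) windows only at levels
`j ≥ jlogOf Cw K`; older structure is either HEALED (top-level regular again) or makes the history BAD (weight half,
NE7b).  With the level shares VANISHING below the logarithmic cut and bounded on the window by `F·Λ^{K−j}` (`Λ = L⁴`;
`F ≤ 1` PER TERM — a volume fraction is `≤ 1`, NO density statement), the majorant is summable for EVERY
`0 < θ < 1 ≤ Λ` (`summable_of_levels_logWindow`, `summable_of_volumeFraction_logWindow`; explicit loss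
`levels_logWindow_le` = `poly(K)·θ^K`); opened to ALL ages the same sum is `≥ Λ^K`, NOT summable
(`not_summable_windowSum_allAges`) — the window is load-bearing.  CONSEQUENCE for the census of the term-wise action
kind: through the level-graded one-step sandwich the action kind DOES reach the I-3 good class, GIVEN level-graded
regularity binders on the young pending windows (printed currency per level, both runs — the lineage's Theorem-1
plumbing indexed by level) and the clause that the ledger's `Bad K t` contains every history with pending structure
older than the cut (interface I-3; in the ledger only the boundary kind's `RecentOnly` is explicit so far); what the
sandwich does not reach — old UNHEALED rough structure — I-3 assigns to the bad class anyway; the residual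
`K`-persistent species in the MAIN action on old HEALED islands, the coupling lag of [Balaban1988Convergent] (2.24),
has a `K`-uniform profile for which `TermwiseHeterogeneous` §4 applies verbatim (its island-density clause is a
weight-half input).  The statements below were proposed by the cell's NE7 ideation seat (memo `IDEAS-NE7-g26.md`,
scratch `g26/Sketch.lean` sha16 d259c9781b98091a, route W-C); the row owner lands them, re-proved.  NOT NE7, NOT a
claim about Bałaban's densities, NOT summit progress.
-/

noncomputable section

open Finset _root_.Filter _root_.Topology
open scoped BigOperators

namespace Summit.QuantumFields.BalabanUV.T4Continuum.TermwiseHeterogeneous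

/-! ## §6 The level-graded majorant under the logarithmic window -/

section Window

open Literature.MathematicalPhysics.QuantumFieldTheory.Balaban1983to89.T4GoodClassBudget (windowSum jlogOf
  summable_windowSum_log)
open Literature.MathematicalPhysics.QuantumFieldTheory.Balaban1983to89.T4MatchingClosure (windowSum_log_le)

/-- **LEVEL SUM ≤ WINDOW SUM.**  If the level shares are `≤ 0` below `j₀` and `≤ F·Λ^{K−j}` on `[j₀, K]`, then
`Σ_{j ≤ K} μ_j θ^j ≤ F · windowSum θ Λ j₀ K` (`0 ≤ θ`). [folklore] -/
theorem sum_range_le_windowSum {μ : ℕ → ℝ} {θ Λ F : ℝ} (hθ : 0 ≤ θ) {j₀ K : ℕ}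
    (hzero : ∀ j < j₀, μ j ≤ 0) (hwin : ∀ j, j₀ ≤ j → j ≤ K → μ j ≤ F * Λ ^ (K - j)) :
    ∑ j ∈ Finset.range (K + 1), μ j * θ ^ j ≤ F * windowSum θ Λ j₀ K := by
  have hfilter : (Finset.range (K + 1)).filter (fun j => j₀ ≤ j) = Finset.Icc j₀ K := by
    ext j
    simp only [Finset.mem_filter, Finset.mem_range, Finset.mem_Icc]
    omega
  have h1 : ∑ j ∈ Finset.range (K + 1), μ j * θ ^ j
      ≤ ∑ j ∈ Finset.range (K + 1), (if j₀ ≤ j then F * Λ ^ (K - j) * θ ^ j else 0) := by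
    refine Finset.sum_le_sum fun j hj => ?_
    have hjK : j ≤ K := Nat.lt_succ_iff.mp (Finset.mem_range.mp hj)
    by_cases h : j₀ ≤ j
    · rw [if_pos h]
      exact mul_le_mul_of_nonneg_right (hwin j h hjK) (pow_nonneg hθ _)
    · rw [if_neg h]
      exact mul_nonpos_of_nonpos_of_nonneg (hzero j (not_le.mp h)) (pow_nonneg hθ _)
  have h2 : ∑ j ∈ Finset.range (K + 1), (if j₀ ≤ j then F * Λ ^ (K - j) * θ ^ j else 0)
      = F * windowSum θ Λ j₀ K := by
    rw [← Finset.sum_filter, hfilter, windowSum, Finset.mul_sum]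
    exact Finset.sum_congr rfl fun j _ => by ring
  exact h1.trans h2.le

/-- **THE WINDOWED CENSUS (summability).**  The level-graded majorant `δ K ≤ C·Σ_{j ≤ K} μ_K(j)·θ^j` with level shares
VANISHING below the logarithmic cut `jlogOf Cw K` (interface I-3: good histories carry only pending structure born in
the window) and bounded by `F·Λ^{K−j}` on the window is summable for EVERY `0 < θ < 1 ≤ Λ` — no condition linking `θ`
and `Λ`, no `K`-uniform age profile, no density statement (`F = 1` per term). [folklore] -/
theorem summable_of_levels_logWindow {δ : ℕ → ℝ} {μ : ℕ → ℕ → ℝ} {C θ Λ F Cw : ℝ} (hC : 0 ≤ C)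
    (hθ : 0 < θ) (hθ1 : θ < 1) (hΛ : 1 ≤ Λ) (hCw : 0 ≤ Cw) (hδ0 : ∀ K, 0 ≤ δ K)
    (hδ : ∀ K, δ K ≤ C * ∑ j ∈ Finset.range (K + 1), μ K j * θ ^ j)
    (hold : ∀ K, ∀ j < jlogOf Cw K, μ K j ≤ 0)
    (hyoung : ∀ K j, jlogOf Cw K ≤ j → j ≤ K → μ K j ≤ F * Λ ^ (K - j)) :
    Summable δ := by
  refine Summable.of_nonneg_of_le hδ0 (fun K => (hδ K).trans ?_)
    ((summable_windowSum_log hθ hθ1 hΛ hCw).mul_left (C * F))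
  rw [mul_assoc]
  exact mul_le_mul_of_nonneg_left (sum_range_le_windowSum hθ.le (hold K) (hyoung K)) hC

/-- **THE WINDOWED CENSUS (explicit loss).**  Under the same hypotheses the majorant is `poly(K)·θ^K`:
`δ K ≤ C·F·(Cw+2)·θ⁻¹Λ·(K+1)^{⌈Cw log θ⁻¹ + Cw log Λ⌉+1}·θ^K`. [folklore] -/
theorem levels_logWindow_le {δ : ℕ → ℝ} {μ : ℕ → ℕ → ℝ} {C θ Λ F Cw : ℝ} (hC : 0 ≤ C)
    (hθ : 0 < θ) (hθ1 : θ < 1) (hΛ : 1 ≤ Λ) (hF : 0 ≤ F) (hCw : 0 ≤ Cw)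
    (hδ : ∀ K, δ K ≤ C * ∑ j ∈ Finset.range (K + 1), μ K j * θ ^ j)
    (hold : ∀ K, ∀ j < jlogOf Cw K, μ K j ≤ 0)
    (hyoung : ∀ K j, jlogOf Cw K ≤ j → j ≤ K → μ K j ≤ F * Λ ^ (K - j)) (K : ℕ) :
    δ K ≤ C * F * ((Cw + 2) * (θ⁻¹ * Λ) *
      (((K : ℝ) + 1) ^ (⌈Cw * Real.log θ⁻¹ + Cw * Real.log Λ⌉₊ + 1) * θ ^ K)) := by
  calc δ K ≤ C * ∑ j ∈ Finset.range (K + 1), μ K j * θ ^ j := hδ K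
    _ ≤ C * (F * windowSum θ Λ (jlogOf Cw K) K) :=
        mul_le_mul_of_nonneg_left (sum_range_le_windowSum hθ.le (hold K) (hyoung K)) hC
    _ ≤ C * (F * ((Cw + 2) * (θ⁻¹ * Λ) *
          (((K : ℝ) + 1) ^ (⌈Cw * Real.log θ⁻¹ + Cw * Real.log Λ⌉₊ + 1) * θ ^ K))) :=
        mul_le_mul_of_nonneg_left (mul_le_mul_of_nonneg_left (windowSum_log_le hθ hθ1 hΛ hCw K) hF) hC
    _ = _ := by ring

/-- **THE WINDOWED CENSUS IN §3's CURRENCY.**  Level shares `μ_K(j) = f_K(j)·Λ^{K−j}` (roughness-weighted volume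
fraction, `Λ = L⁴`) with volume fractions `f_K(j) ≤ 1` that VANISH below the logarithmic cut (I-3): the majorant
`δ K ≤ C·Σ_{j≤K} (f_K(j)Λ^{K−j})θ^j` is summable for every `0 < θ < 1 ≤ Λ` — per term, with NO density statement.
This is the verdict for the I-3 good class (replacing §4's «King-type class only» as far as the good class is
concerned). [folklore] -/
theorem summable_of_volumeFraction_logWindow {δ : ℕ → ℝ} {f : ℕ → ℕ → ℝ} {C θ Λ Cw : ℝ} (hC : 0 ≤ C)
    (hθ : 0 < θ) (hθ1 : θ < 1) (hΛ : 1 ≤ Λ) (hCw : 0 ≤ Cw) (hδ0 : ∀ K, 0 ≤ δ K)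
    (hδ : ∀ K, δ K ≤ C * ∑ j ∈ Finset.range (K + 1), (f K j * Λ ^ (K - j)) * θ ^ j)
    (hf1 : ∀ K j, f K j ≤ 1) (hfold : ∀ K, ∀ j < jlogOf Cw K, f K j ≤ 0) :
    Summable δ := by
  have hΛ0 : 0 ≤ Λ := zero_le_one.trans hΛ
  refine summable_of_levels_logWindow (μ := fun K j => f K j * Λ ^ (K - j)) (F := 1) hC hθ hθ1 hΛ
    hCw hδ0 hδ (fun K j hj => ?_) (fun K j _ _ => ?_)
  · exact mul_nonpos_of_nonpos_of_nonneg (hfold K j hj) (pow_nonneg hΛ0 _)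
  · simpa using mul_le_mul_of_nonneg_right (hf1 K j) (pow_nonneg hΛ0 (K - j))

/-- **CONTROL: THE WINDOW IS LOAD-BEARING.**  Opened to ALL ages (`j⋆ = 0`), the roughness-weighted window sum is
`≥ Λ^K ≥ 1` at every cutoff, hence NOT summable, for every `θ ≥ 0`, `Λ ≥ 1` — §4's all-ages verdict in window form.
[folklore] -/
theorem not_summable_windowSum_allAges {θ Λ : ℝ} (hθ : 0 ≤ θ) (hΛ : 1 ≤ Λ) :
    ¬ Summable (fun K => windowSum θ Λ 0 K) := by
  intro h
  have h1 : ∀ K, (1 : ℝ) ≤ windowSum θ Λ 0 K := fun K => by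
    unfold windowSum
    have hmem : 0 ∈ Finset.Icc 0 K := by simp
    calc (1 : ℝ) ≤ θ ^ 0 * Λ ^ (K - 0) := by simpa using one_le_pow₀ (M₀ := ℝ) hΛ (n := K)
      _ ≤ ∑ j ∈ Finset.Icc 0 K, θ ^ j * Λ ^ (K - j) :=
          Finset.single_le_sum (f := fun j => θ ^ j * Λ ^ (K - j))
            (fun j _ => mul_nonneg (pow_nonneg hθ _) (pow_nonneg (zero_le_one.trans hΛ) _)) hmem
  obtain ⟨K, hK⟩ := (h.tendsto_atTop_zero.eventually (gt_mem_nhds zero_lt_one)).exists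
  exact absurd (h1 K) (not_le.mpr hK)

end Window

end Summit.QuantumFields.BalabanUV.T4Continuum.TermwiseHeterogeneous
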